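import Summits.Langlands.Langlands.Theorems.ParityBlindBianchiResidualBianchiDoorLevelBC
import Summits.Langlands.Langlands.Theorems.ParityBlindBianchiResidualBianchiDoorLevelBCQLevelTwo
import HarnessLib

/-!
# `ResidualBianchiDoorLevelBC` (E1″, crux stmt-Langlands-16853) BY NAME from Serre's conjecture MOD 2 alone

Companion of `ParityBlindBianchiResidualBianchiDoorLevelBC.lean` (line `Sketch`, idea
`fibre-substitution`): the unconditional transfer `ResidualBianchiDoorLevelBC_of_qLevelPackage`
landed there is fed with the sharper engine `Sketch.stub_qLevel_two`
(`ParityBlindBianchiResidualBianchiDoorLevelBCQLevelTwo.lean`), whose only hypothesis is the `p = 2`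
fibre `∀ k, khare_wintenberger 2 k` of the tree's named fact — Serre's modularity conjecture mod `2`
(Khare–Wintenberger (I) Thm 1.2 for `k(ρ̄) = 2`; Thm 9.1 under Kisin's 2-adic Hypothesis (H) for
`k(ρ̄) = 4`).  This is the minimal displayed debt of the line and the promotion-ready form: should
the route ever take Serre-mod-2 as an antecedent by name, the restated door is closed by
`fun h2 => ResidualBianchiDoorLevelBC_of_serreModTwo h2`.  The filed form
`ResidualBianchiDoorLevelBC_of_KW` (all `p`, landed in the companion file) is its specialisation
`p := 2`.
-/

noncomputable section

-- single-conjunct summit: every name here is `Summit.Langlands.Langlands.…` (Sub = Summit), which the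
-- dupNamespace linter flags by design of the tree layout
set_option linter.dupNamespace false

namespace Summit.Langlands.Langlands.Theorems.ParityBlindBianchi

open Literature.NumberTheory.Automorphic
  Summit.Langlands.Langlands.Cruxes.ResidualBianchiDoorLevel

/-- **E1″ from Serre's conjecture MOD 2 alone** (crux `ResidualBianchiDoorLevelBC` BY NAME).  For
`ι : ℚ̄₂ ≃+* ℂ` and an irreducible icosahedral Artin `ρ : Γ_ℚ → GL₂(ℂ)`, granted quadratic base
change for `GL₂` (the antecedent `QuadraticBaseChangeGL2`, a crux of the route): there is a finite
set `S₀` of naturals with `2 ∈ S₀`, `0 ∉ S₀` (indeed a set of primes) such that for every imaginary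
quadratic `K` with `2` split, `σ := ι⁻¹ ∘ ρ|_{Γ_K}` entrywise is a framed representation over `ℚ̄₂`
of finite image, irreducible, projectively `A₅`, and a regular algebraic cuspidal `π₀` on
`GL₂(𝔸_K)` is congruent to `σ` (coefficientwise in `𝔪_{ℤ̄₂}`, HLTT normalisation `m = 2`) at every
place of `K` over no prime of `S₀`.  Proof: the transfer `ResidualBianchiDoorLevelBC_of_qLevelPackage`
fed with the engine `Sketch.stub_qLevel_two` (Serre mod `2`, odd for free: the ℚ-level newform,
its conjugate, the adelic lift and the `m = 2` congruence).  CONDITIONAL on the single hypothesis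
`∀ k, khare_wintenberger 2 k` (Serre's modularity conjecture mod `2`; Khare–Wintenberger (I)
Thm 1.2 for `k(ρ̄) = 2`, Thm 9.1 under Kisin's 2-adic Hypothesis (H) for `k(ρ̄) = 4`), an in-tree
named fact not restated here — the minimal displayed debt of the line, promotion-ready.
[cite: KhareWintenberger2009, Thm. 1.2 and Thm. 9.1] [cite: Kisin2009TwoAdic, Thm. 0.1, Cor. 0.2]
[cite: ArthurClozelAMS120, Ch. 3 Thm. 4.2 (a) and Thm. 5.1] -/
theorem ResidualBianchiDoorLevelBC_of_serreModTwo
    (hKW2 : ∀ (k : Type) [Field k] [TopologicalSpace k] [DiscreteTopology k],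
      khare_wintenberger 2 k) :
    Summit.Langlands.Langlands.Theses.ParityBlindBianchi.ResidualBianchiDoorLevelBC :=
  ResidualBianchiDoorLevelBC_of_qLevelPackage fun ι ρ _ hA5 => Sketch.stub_qLevel_two hKW2 ι ρ hA5

end Summit.Langlands.Langlands.Theorems.ParityBlindBianchi

end
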